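import Literature.AlgebraicGeometry.GroupSchemes.BTGroupFrobeniusKernelInCoordinates
import Literature.AlgebraicGeometry.GroupSchemes.InfinitesimalKilledByFrobeniusPower
import Literature.AlgebraicGeometry.GroupSchemes.AffineGroupSchemeIsoSpec
import Literature.AlgebraicGeometry.GroupSchemes.GroupSchemeKernelAlg
import Mathlib.RingTheory.HopfAlgebra.GroupLike
import HarnessLib

/-!
# A scheme whose functions are spanned by `p^t`-th roots of unity (a diagonalizable group killed by `p^t`) is killed by `F^t`
# (SGA 3 VII_A 4.1; Demazure 1972 II §7, III §6; Tate 1997 (3.7))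

Topic `Literature/AlgebraicGeometry/GroupSchemes`; namespaces `Literature.AlgebraicGeometry.GroupSchemes` (§1–§3, §5),
`Literature.AlgebraicGeometry.GroupSchemes.AffineGroupScheme` (§4), `Literature.AlgebraicGeometry.Motives.AbelianVariety` (§3b).  THEOREMS ONLY
(no definition, no instance, no notation, no named fact, no `sorry`).  Cell `hodgecm-mathlib` (D-0151), programme P6 «MOD» (crux hLiu418 =
stmt-HodgeConjecture-24832, `--supports`, count-neutral): the MULTIPLICATIVE half (M1) of organ (O-δ) «MULT-BLOCK ∕ FROB₀-UNIT» of the P6a desk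
(F0P6a-plan (g1) ORGAN DEALS #1, 2026-09-01 18:10Z; lead hand B-p17 (g27) `KernelRecognitionByRank`, this half B-p04 (g38)): the companion of ★
`InfinitesimalKilledByFrobeniusPower` (p845102) with the nilpotent augmentation ideal replaced by a basis of `q`-th roots of unity.  HC_CM is proved
only modulo the printed citations until rung 0 closes; this file is generic and changes no count.

THE PRINT.  [SGA3I] Exp. VII_A 4.1: the relative Frobenius `F_{G∕k} : G → G^{(p)}` and its iterates; [Demazure1972] Ch. II §7–§8 and III §6:
a finite commutative `k`-group is multiplicative iff its Cartier dual is étale, the diagonalizable groups `D(M) = Spec k[M]` (`M` a finite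
abelian group; `Γ` has the `k`-basis `M` of group-like elements) are the split ones, and on `D(M)` the Frobenius is induced by `m ↦ m^p`;
[Tate1997FiniteFlatGroupSchemes] (3.7): over `k = k̄` every finite commutative `G` is `G⁰ × G^{ét}` and `(G^{ét})^D` is multiplicative.
CONSEQUENCE typed here, in the exact currency of ★ p845102: if the global functions of an affine `k`-scheme `X` (exponential characteristic
`p`) are SPANNED over `k` by elements `g` with `g^{p^t} = 1`, then for every `k`-point `e` of `X` the absolute `p^t`-Frobenius `s ↦ s^{p^t}` of
`X` equals `(X → Spec k) ≫ Spec Frob^t ≫ e` (on `s = Σ cᵢ gᵢ` both give `Σ cᵢ^{p^t}`); hence a `k`-GROUP scheme `G` with this property satisfies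
`F^t_{G∕k} = 1`, every unit-preserving `c : H → G` from such an `H` has `c ≫ F^t_{G∕k} = 1` (and the abelian-variety forms), and the spanning
hypothesis holds for a group scheme killed by `p^t` whose algebra is spanned by GROUP-LIKE elements (`Γ((𝟙)^n) = id^{⋆n}` takes a group-like
`g` to `g^n`) — i.e. for diagonalizable groups; that «`G^D` étale over `k = k̄` ⇒ `Γ(G)` has a basis of group-likes» is the sequel
`DiagonalizableOfEtaleCartierDual`.

* §1 ALGEBRA: `map_pow_eq_map_pow_of_span_pow_eq_one` — two `k`-algebra maps agree on `s^{p^t}` when the source is spanned by `p^t`-th roots of `1`.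
* §2 SCHEME: **`absFrobeniusOver_eq_hom_comp_frobSpec_comp_left_of_span_pow_eq_one`** (`F^{abs,t}_X = (X → Spec k) ≫ Spec Frob^t ≫ e`).
* §3 GROUP SCHEMES: **`relFrobeniusOver_eq_one_of_span_pow_eq_one`** (`F^t_{G∕k} = 1`), **`comp_relFrobeniusOver_eq_one_of_span_pow_eq_one`**
  (`c ≫ F^t_{G∕k} = 1` for unit-preserving `c : H → G`); §3b abelian varieties: `comp_relFrobenius_eq_one_of_span_pow_eq_one`,
  `kerLift_relFrobenius_comp_kerι_of_span_pow_eq_one`, `isClosedImmersion_kerLift_relFrobenius_left_of_span_pow_eq_one` (token-parallel to ★ p845102 §3).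
* §4 GROUP-LIKES: `Alg.comap_pow_id_apply_of_isGroupLikeElem` (`Γ((𝟙 G)^n) g = g^n`), **`pow_eq_one_of_isGroupLikeElem_of_id_pow_eq_one`**
  (`(𝟙 G)^n = 1 ⇒ g^n = 1`), `span_pow_eq_one_eq_top_of_span_isGroupLikeElem_eq_top`.
* §5 HEAD **`relFrobeniusOver_eq_one_of_span_isGroupLikeElem_of_id_pow_eq_one`**: a `k`-group scheme whose algebra is spanned by group-likes
  (DIAGONALIZABLE) and which is killed by `p^t` is killed by `F^t_{G∕k}`.

FALSE VARIANTS: «killed by `p^t` ⇒ killed by `F^t`» fails without diagonalizability (`ℤ∕p`: étale, `F` an isomorphism); «spanned by group-likes ⇒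
killed by `F`» fails without the exponent (`μ_{p²} ⊄ ker F`).

## References
* [SGA3I] M. Demazure, A. Grothendieck (eds.), *SGA 3, Tome I*, Exp. VII_A (P. Gabriel), 4.1.
* [Demazure1972] M. Demazure, *Lectures on p-divisible groups*, LNM 302 (1972), Ch. II §7–§8, Ch. III §6.
* [Tate1997FiniteFlatGroupSchemes] J. Tate, *Finite flat group schemes* (1997), (3.7).
* [GortzWedhorn2020] U. Görtz, T. Wedhorn, *Algebraic Geometry I* (2nd ed.), Definition 4.45 (2) (p. 117).
* [GortzWedhorn2023] U. Görtz, T. Wedhorn, *Algebraic Geometry II* (2023), §(27.2) (27.2.1) (pp. 606–607).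
-/

set_option autoImplicit false

noncomputable section

-- `AffineGroupScheme.Alg X = Γ(X.left, ⊤)`, `(𝟙_ (Over S)).left = S`, `(A.relFrobenius p t).hom.hom.hom` are definitional only above `instances`
-- transparency (as in ★ `InfinitesimalKilledByFrobeniusPower`); the option is set PER DECLARATION (file-wide it slows the instance search for
-- `1 : T ⟶ G^{(q)}` on the transported group object, cf. ★ `AbelianVarietyFrobeniusKernelBlocks`).

open CategoryTheory CategoryTheory.Limits AlgebraicGeometry MonoidalCategory CartesianMonoidalCategory

open scoped MonObj CategoryTheory.Obj

universe u

namespace Literature.AlgebraicGeometry.GroupSchemes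

open Literature.AlgebraicGeometry.Motives

variable {k : Type u} [Field k] (p : ℕ) [ExpChar k p] (t : ℕ)

/-! ## §1 Algebra: `k`-algebra maps agree on `p^t`-th powers when the source is spanned by `p^t`-th roots of unity -/

omit [ExpChar k p] in
/-- **Two `k`-algebra maps `π₁ π₂ : B → C` satisfy `π₁(s)^{p^t} = π₂(s)^{p^t}`** when `B` is spanned over `k` by elements `g` with `g^{p^t} = 1` and
`(x + y)^{p^t} = x^{p^t} + y^{p^t}` in `C`: on `s = Σ cᵢ gᵢ` both sides are `Σ cᵢ^{p^t}` (`πⱼ(gᵢ)^{p^t} = πⱼ(gᵢ^{p^t}) = 1`).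
[cite: Demazure1972, Ch. II §8] -/
theorem map_pow_eq_map_pow_of_span_pow_eq_one {B C : Type*} [CommRing B] [Algebra k B] [CommRing C] [Algebra k C]
    (hadd : ∀ x y : C, (x + y) ^ p ^ t = x ^ p ^ t + y ^ p ^ t) (π₁ π₂ : B →ₐ[k] C)
    (hspan : Submodule.span k {g : B | g ^ p ^ t = 1} = ⊤) (s : B) : (π₁ s) ^ p ^ t = (π₂ s) ^ p ^ t := by
  have hs : s ∈ Submodule.span k {g : B | g ^ p ^ t = 1} := by rw [hspan]; exact Submodule.mem_top
  induction hs using Submodule.span_induction with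
  | mem g hg =>
    have hg' : g ^ p ^ t = 1 := hg
    rw [← map_pow, ← map_pow, hg', map_one, map_one]
  | zero => rw [map_zero, map_zero]
  | add x y _ _ hx hy => rw [map_add, map_add, hadd, hadd, hx, hy]
  | smul c x _ hx => rw [map_smul, map_smul, smul_pow, smul_pow, hx]

/-! ## §2 Schemes: the `p^t`-Frobenius collapses onto any `k`-point -/

section Scheme

variable (X : SchemeOver k) [IsAffine X.left] (e : 𝟙_ (SchemeOver k) ⟶ X)

set_option backward.isDefEq.respectTransparency false in
/-- **THE `p^t`-FROBENIUS OF `X` COLLAPSES ONTO ITS `k`-POINT `e`** when `Γ(X)` is spanned over `k` by `p^t`-th roots of unity: the absolute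
`p^t`-Frobenius of the affine `k`-scheme `X` (identity on the space, `s ↦ s^{p^t}` on functions) equals `(X → Spec k) ≫ Spec Frob^t ≫ e`.  On global
sections: `s^{p^t} = π(s)^{p^t}` for `π := Γ((X → Spec k) ≫ e)` by §1, and `π(s)^{p^t} = (X → Spec k)♯ (Frob^t (e♯ s))`; a morphism into the affine `X`
is determined by global sections (the proof shape of ★ `absFrobeniusOver_eq_hom_comp_frobSpec_comp_left`).
[cite: Demazure1972, Ch. II §8] [cite: SGA3I, VII_A 4.1] -/
theorem absFrobeniusOver_eq_hom_comp_frobSpec_comp_left_of_span_pow_eq_one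
    (hspan : Submodule.span k {g : AffineGroupScheme.Alg X | g ^ p ^ t = 1} = ⊤) :
    absFrobeniusOver p t X = X.hom ≫ frobSpec k p t ≫ e.left := by
  refine ext_of_isAffine ?_
  ext s
  rw [powEndo_appTop_apply]
  rw [Scheme.Hom.comp_appTop, Scheme.Hom.comp_appTop]
  change s ^ p ^ t = X.hom.appTop ((frobSpec k p t).appTop (e.left.appTop s))
  have hfrob : (frobSpec k p t).appTop (e.left.appTop s) = (e.left.appTop s) ^ p ^ t := by
    rw [← absFrobeniusOver_tensorUnit p t]
    exact powEndo_appTop_apply _ _ _ _ _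
  rw [hfrob, map_pow]
  -- `π := Γ((X → Spec k) ≫ e)`, a `k`-algebra endomorphism of `Γ(X)` with `π s = (X → Spec k)♯ (e♯ s)`
  have hu : (toUnit X).left = X.hom := (Category.comp_id _).symm.trans (Over.w (toUnit X))
  have hπ : ∀ a : AffineGroupScheme.Alg X, AffineGroupScheme.Alg.comap (toUnit X ≫ e) a = X.hom.appTop (e.left.appTop a) := fun a => by
    rw [AffineGroupScheme.Alg.comap_apply, Over.comp_left, hu, Scheme.Hom.comp_appTop]
    rfl
  rw [← hπ]
  exact map_pow_eq_map_pow_of_span_pow_eq_one p t (B := AffineGroupScheme.Alg X) (C := AffineGroupScheme.Alg X)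
    (fun x y => add_pow_expChar_pow_sections p t X ⊤ x y) (AlgHom.id k _) (AffineGroupScheme.Alg.comap (toUnit X ≫ e)) hspan s

end Scheme

/-! ## §3 Group schemes: `F^t_{G∕k} = 1` -/

section GroupScheme

variable {H : SchemeOver k} (G : SchemeOver k) [GrpObj G]

set_option backward.isDefEq.respectTransparency false in
set_option synthInstance.maxHeartbeats 200000 in
-- `1 : _ ⟶ G^{(p^t)}` on the transported group object (as in ★ `FrobeniusKillsImage`, ★ `BTGroupFrobeniusKernelInCoordinates` §2)
/-- **`F^t_{G∕k} = 1` FOR A `k`-GROUP SCHEME WHOSE FUNCTIONS ARE SPANNED BY `p^t`-TH ROOTS OF UNITY** (a closed subgroup of a product of `μ_{p^t}`s;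
the transported group structure on `G^{(p^t)}`): ★ criterion `comp_relFrobeniusOver_eq_one_iff_unit` at `c = 𝟙 G` and §2 at `e = e_G`.
[cite: SGA3I, VII_A 4.1] [cite: Demazure1972, Ch. III §6] -/
theorem relFrobeniusOver_eq_one_of_span_pow_eq_one [IsAffine G.left]
    (hspan : Submodule.span k {g : AffineGroupScheme.Alg G | g ^ p ^ t = 1} = ⊤) : relFrobeniusOver p t G = 1 := by
  have h := (comp_relFrobeniusOver_eq_one_iff_unit p t (𝟙 G)).2 (by
    rw [Over.id_left, Category.comp_id]
    exact absFrobeniusOver_eq_hom_comp_frobSpec_comp_left_of_span_pow_eq_one p t G η[G] hspan)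
  rwa [Category.id_comp] at h

variable {G} in
set_option backward.isDefEq.respectTransparency false in
set_option synthInstance.maxHeartbeats 200000 in
-- `1 : _ ⟶ G^{(p^t)}` on the transported group object (as in ★ `FrobeniusKillsImage`, ★ `BTGroupFrobeniusKernelInCoordinates` §2)
/-- **A unit-preserving `c : H → G` from an affine `k`-scheme `H` spanned by `p^t`-th roots of unity is killed by `F^t_{G∕k}`**: `c ≫ F^t_{G∕k} = 1`
(`H` need not be a group; `e` is any `k`-point of `H` with `e ≫ c = e_G`). [cite: SGA3I, VII_A 4.1] [cite: Demazure1972, Ch. III §6] -/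
theorem comp_relFrobeniusOver_eq_one_of_span_pow_eq_one [IsAffine H.left] (c : H ⟶ G) (e : 𝟙_ (SchemeOver k) ⟶ H) (hc : e ≫ c = η[G])
    (hspan : Submodule.span k {g : AffineGroupScheme.Alg H | g ^ p ^ t = 1} = ⊤) : c ≫ relFrobeniusOver p t G = 1 := by
  rw [comp_relFrobeniusOver_eq_one_iff_unit, absFrobeniusOver_eq_hom_comp_frobSpec_comp_left_of_span_pow_eq_one p t H e hspan,
    Category.assoc, Category.assoc, ← Over.comp_left, hc]

end GroupScheme

end Literature.AlgebraicGeometry.GroupSchemes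

/-! ## §3b Abelian varieties: subgroups spanned by roots of unity lie in the Frobenius kernel -/

namespace Literature.AlgebraicGeometry.Motives.AbelianVariety

open Literature.AlgebraicGeometry.GroupSchemes Literature.AlgebraicGeometry.GroupSchemes.GroupSchemeKernel

variable {k : Type u} [Field k] (p : ℕ) [ExpChar k p] (t : ℕ) (A : AbelianVariety k)
  {H : SchemeOver k} [GrpObj H] [IsAffine H.left] (c : H ⟶ A.X)

set_option backward.isDefEq.respectTransparency false in
/-- **A `k`-GROUP SCHEME SPANNED BY `p^t`-TH ROOTS OF UNITY IS KILLED BY `F^t`** inside an abelian variety: for a unit-preserving `k`-morphism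
`c : H → A` (a homomorphism, a closed subgroup) from an affine `k`-group scheme `H` whose functions are spanned by `p^t`-th roots of unity, the
composite with `F^t_{A∕k} : A → A^{(p^t)}` is the trivial homomorphism (the proof of ★ `comp_relFrobenius_eq_one_of_subsingleton_of_finrank_le`
with §2 in place of the nilpotence lemma). [cite: Demazure1972, Ch. III §6] [cite: Tate1997FiniteFlatGroupSchemes, (3.7)] -/
theorem comp_relFrobenius_eq_one_of_span_pow_eq_one (hc : η[H] ≫ c = η[A.X])
    (hspan : Submodule.span k {g : AffineGroupScheme.Alg H | g ^ p ^ t = 1} = ⊤) :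
    c ≫ (A.relFrobenius p t).hom.hom.hom = 1 := by
  apply frobeniusTwistOver_hom_ext p t
  rw [comp_relFrobenius_left_comp_twistFst,
    absFrobeniusOver_eq_hom_comp_frobSpec_comp_left_of_span_pow_eq_one p t H η[H] hspan, Category.assoc, Category.assoc, ← Over.comp_left, hc]
  have hu : (toUnit H).left = H.hom := (Category.comp_id _).symm.trans (Over.w (toUnit H))
  rw [Hom.one_def, Over.comp_left, Category.assoc, ← one_comp_relFrobeniusOver, ← relFrobenius_hom_hom_hom,
    comp_relFrobenius_left_comp_twistFst, absFrobeniusOver_tensorUnit, hu]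

set_option backward.isDefEq.respectTransparency false in
/-- Hence `c` factors through the Frobenius kernel: `kerLift c _ ≫ ι = c` with `ι : Ker F^t_{A∕k} → A`. [cite: GortzWedhorn2020, Definition 4.45 (2) (p. 117)] -/
theorem kerLift_relFrobenius_comp_kerι_of_span_pow_eq_one (hc : η[H] ≫ c = η[A.X])
    (hspan : Submodule.span k {g : AffineGroupScheme.Alg H | g ^ p ^ t = 1} = ⊤) :
    kerLift c (comp_relFrobenius_eq_one_of_span_pow_eq_one p t A c hc hspan) ≫ kerι (A.relFrobenius p t).hom.hom.hom = c :=
  kerLift_ι _ _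

set_option backward.isDefEq.respectTransparency false in
/-- If `c` is a closed immersion, the factorisation `H → Ker F^t_{A∕k}` is a CLOSED IMMERSION. [cite: GortzWedhorn2020, Definition 4.45 (2) (p. 117)] -/
theorem isClosedImmersion_kerLift_relFrobenius_left_of_span_pow_eq_one [IsClosedImmersion c.left] (hc : η[H] ≫ c = η[A.X])
    (hspan : Submodule.span k {g : AffineGroupScheme.Alg H | g ^ p ^ t = 1} = ⊤) :
    IsClosedImmersion (kerLift c (comp_relFrobenius_eq_one_of_span_pow_eq_one p t A c hc hspan)).left := by
  haveI : IsClosedImmersion (kerι (A.relFrobenius p t).hom.hom.hom).left := isClosedImmersion_kerι_left_of_isSeparated _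
  have h : (kerLift c (comp_relFrobenius_eq_one_of_span_pow_eq_one p t A c hc hspan)).left ≫
      (kerι (A.relFrobenius p t).hom.hom.hom).left = c.left := by
    rw [← Over.comp_left, kerLift_ι]
  haveI : IsClosedImmersion ((kerLift c (comp_relFrobenius_eq_one_of_span_pow_eq_one p t A c hc hspan)).left ≫
      (kerι (A.relFrobenius p t).hom.hom.hom).left) := by
    rw [h]; infer_instance
  exact IsClosedImmersion.of_comp _ (kerι (A.relFrobenius p t).hom.hom.hom).left

end Literature.AlgebraicGeometry.Motives.AbelianVariety

/-! ## §4 Group-like elements: `Γ((𝟙 G)^n) g = g^n`, so a group scheme killed by `n` has group-likes of order dividing `n` -/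

namespace Literature.AlgebraicGeometry.GroupSchemes

namespace AffineGroupScheme

open Literature.AlgebraicGeometry.Motives Literature.NumberTheory.DiophantineGeometry WithConv

variable {R : Type u} [CommRing R] (G : SchemeOver R) [GrpObj G] [IsAffine G.left]

set_option backward.isDefEq.respectTransparency false in
/-- **`Γ((𝟙 G)^n) = id^{⋆n}`**: the algebra map of the `n`-th power map `(𝟙 G)^n : G → G` (the pointwise `n`-th power in the group `Hom(G, G)`) is the
`n`-th CONVOLUTION power of `id_{Γ(G)}` (★ `comap_eq_ptEquiv`: `Γ(w)` is the algebra map of the point `Spec Γ(G) ≅ G → G`; ★ `ptMulEquiv`: points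
multiply by convolution). [cite: GortzWedhorn2023, §(27.2) (27.2.1) (pp. 606–607)] -/
theorem Alg.comap_pow_id (n : ℕ) :
    Alg.comap ((𝟙 G) ^ n) = ofConv ((toConv (AlgHom.id R (Alg G)) : WithConv (Alg G →ₐ[R] Alg G)) ^ n) := by
  rw [comap_eq_ptEquiv, MonObj.comp_pow, Category.comp_id]
  have h : ptEquiv G (Alg G) ((isoSpecOver G).inv ^ n) = ofConv (ptMulEquiv G (Alg G) ((isoSpecOver G).inv ^ n)) := by
    rw [ptMulEquiv_apply, ofConv_toConv]
  rw [h, map_pow, ptMulEquiv_apply]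
  congr 3
  rw [← Category.comp_id (isoSpecOver G).inv, ← comap_eq_ptEquiv, Alg.comap_id]

/-- **Evaluation at a group-like element is multiplicative for convolution**: `(φ ⋆ ψ)(g) = φ(g) ψ(g)` (`Δ g = g ⊗ g`).
[cite: GortzWedhorn2023, §(27.2) (27.2.1) (pp. 606–607)] -/
theorem convMul_apply_of_isGroupLikeElem {A B : Type*} [CommRing A] [Bialgebra R A] [CommRing B] [Algebra R B]
    (φ ψ : WithConv (A →ₐ[R] B)) {g : A} (hg : IsGroupLikeElem R g) : (φ * ψ) g = φ g * ψ g := by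
  rw [AlgHom.convMul_apply, hg.comul_eq_tmul_self, Algebra.TensorProduct.lift_tmul]

/-- `(φ^{⋆n})(g) = φ(g)^n` at a group-like `g` (`(1 : WithConv)(g) = η(ε g) = 1`). [cite: GortzWedhorn2023, §(27.2) (27.2.1) (pp. 606–607)] -/
theorem convPow_apply_of_isGroupLikeElem {A B : Type*} [CommRing A] [Bialgebra R A] [CommRing B] [Algebra R B]
    (φ : WithConv (A →ₐ[R] B)) {g : A} (hg : IsGroupLikeElem R g) (n : ℕ) : (φ ^ n) g = (φ g) ^ n := by
  induction n with
  | zero => rw [pow_zero, pow_zero, AlgHom.convOne_apply, hg.counit_eq_one, map_one]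
  | succ n ih => rw [pow_succ, pow_succ, convMul_apply_of_isGroupLikeElem _ _ hg, ih]

/-- **`Γ((𝟙 G)^n) g = g^n` for a group-like `g ∈ Γ(G)`** (§4 `Alg.comap_pow_id` evaluated by `convPow_apply_of_isGroupLikeElem`).
[cite: GortzWedhorn2023, §(27.2) (27.2.1) (pp. 606–607)] -/
theorem Alg.comap_pow_id_apply_of_isGroupLikeElem (n : ℕ) {g : Alg G} (hg : IsGroupLikeElem R g) : Alg.comap ((𝟙 G) ^ n) g = g ^ n := by
  rw [Alg.comap_pow_id]
  change ((toConv (AlgHom.id R (Alg G)) : WithConv (Alg G →ₐ[R] Alg G)) ^ n) g = g ^ n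
  rw [convPow_apply_of_isGroupLikeElem _ hg]
  rfl

/-- **A group scheme killed by `n` has group-likes of order dividing `n`: `(𝟙 G)^n = 1 ⇒ g^n = 1`** (`Γ(1) = η ∘ ε`, ★ `comap_one_hom`, and `ε g = 1`).
[cite: Demazure1972, Ch. II §8] [cite: GortzWedhorn2023, §(27.2) (27.2.1) (pp. 606–607)] -/
theorem pow_eq_one_of_isGroupLikeElem_of_id_pow_eq_one {n : ℕ} (hn : (𝟙 G) ^ n = 1) {g : Alg G} (hg : IsGroupLikeElem R g) : g ^ n = 1 := by
  rw [← Alg.comap_pow_id_apply_of_isGroupLikeElem G n hg, hn, comap_one_hom, AlgHom.comp_apply, Bialgebra.counitAlgHom_apply,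
    hg.counit_eq_one, map_one]

/-- Hence **the `p^t`-th roots of unity span `Γ(G)` as soon as the group-likes do and `(𝟙 G)^{p^t} = 1`**. [cite: Demazure1972, Ch. II §8] -/
theorem span_pow_eq_one_eq_top_of_span_isGroupLikeElem_eq_top {n : ℕ} (hn : (𝟙 G) ^ n = 1)
    (hspan : Submodule.span R {g : Alg G | IsGroupLikeElem R g} = ⊤) : Submodule.span R {g : Alg G | g ^ n = 1} = ⊤ :=
  top_le_iff.mp (hspan ▸ Submodule.span_mono fun _ hg => pow_eq_one_of_isGroupLikeElem_of_id_pow_eq_one G hn hg)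

end AffineGroupScheme

/-! ## §5 HEAD: a diagonalizable group scheme killed by `p^t` is killed by `F^t` -/

open Literature.AlgebraicGeometry.Motives

variable {k : Type u} [Field k] (p : ℕ) [ExpChar k p] (t : ℕ)

set_option backward.isDefEq.respectTransparency false in
set_option synthInstance.maxHeartbeats 200000 in
-- `1 : _ ⟶ G^{(p^t)}` on the transported group object (as in ★ `FrobeniusKillsImage`, ★ `BTGroupFrobeniusKernelInCoordinates` §2)
/-- **A DIAGONALIZABLE `k`-GROUP SCHEME KILLED BY `p^t` IS KILLED BY `F^t_{G∕k}`**: if `Γ(G)` is spanned over `k` by its group-like elements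
(`G` is a closed subgroup of a split torus ∕ a `D(M)`) and `(𝟙 G)^{p^t} = 1`, then `relFrobeniusOver p t G = 1` (§4 + §3).  With the sequel
«`G^D` étale over `k = k̄` ⇒ group-likes span» this is «MULTIPLICATIVE + killed by `p^t` ⇒ killed by `F^t`», the `w`-block input of HEART-FROB §B.
[cite: Demazure1972, Ch. III §6] [cite: SGA3I, VII_A 4.1] [cite: Tate1997FiniteFlatGroupSchemes, (3.7)] -/
theorem relFrobeniusOver_eq_one_of_span_isGroupLikeElem_of_id_pow_eq_one (G : SchemeOver k) [GrpObj G] [IsAffine G.left]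
    (hspan : Submodule.span k {g : AffineGroupScheme.Alg G | IsGroupLikeElem k g} = ⊤) (hq : (𝟙 G) ^ p ^ t = 1) :
    relFrobeniusOver p t G = 1 :=
  relFrobeniusOver_eq_one_of_span_pow_eq_one p t G
    (AffineGroupScheme.span_pow_eq_one_eq_top_of_span_isGroupLikeElem_eq_top G hq hspan)

set_option backward.isDefEq.respectTransparency false in
set_option synthInstance.maxHeartbeats 200000 in
-- `1 : _ ⟶ G^{(p^t)}` on the transported group object (as in ★ `FrobeniusKillsImage`, ★ `BTGroupFrobeniusKernelInCoordinates` §2)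
/-- The same for a unit-preserving `c : H → G` out of a diagonalizable `H` killed by `p^t`: `c ≫ F^t_{G∕k} = 1`. [cite: Demazure1972, Ch. III §6] -/
theorem comp_relFrobeniusOver_eq_one_of_span_isGroupLikeElem_of_id_pow_eq_one {H : SchemeOver k} [GrpObj H] [IsAffine H.left]
    (G : SchemeOver k) [GrpObj G] (c : H ⟶ G) (hc : η[H] ≫ c = η[G])
    (hspan : Submodule.span k {g : AffineGroupScheme.Alg H | IsGroupLikeElem k g} = ⊤) (hq : (𝟙 H) ^ p ^ t = 1) :
    c ≫ relFrobeniusOver p t G = 1 :=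
  comp_relFrobeniusOver_eq_one_of_span_pow_eq_one p t c η[H] hc
    (AffineGroupScheme.span_pow_eq_one_eq_top_of_span_isGroupLikeElem_eq_top H hq hspan)

end Literature.AlgebraicGeometry.GroupSchemes

end
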